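import Literature.AlgebraicGeometry.HodgeTheory.ComplexTorusProjectiveRiemannForm
import Literature.AlgebraicGeometry.HodgeTheory.ComplexTorusDimOneAlgebraic
import Literature.Geometry.Kaehler.ComplexTorusRiemannFormTransport
import HarnessLib

/-!
# Every complex torus of dimension one is an abelian variety

Layer `Literature/AlgebraicGeometry/HodgeTheory` (lane `lit-hodgefound`, Layer A2, row A2-10/A2-20).
Lange–Birkenhake, *Complex Abelian Varieties*, Cor. 2.1.14 / Lange (2023) §2.1.1 Example 2.1.3: "every
complex torus of dimension `1` is an abelian variety" (there: by writing down the Riemann form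
`H(v, w) = v w̄ / Im z` for `Λ = ⟨z, 1⟩`; the explicit form for the lattice `ℤτ + ℤ` is
`Geometry/Kaehler/ComplexTorusEllipticCurve.lean`). Here, for an ARBITRARY period isomorphism
`Φ : ℝ^ι ≃ E` onto a one-dimensional complex vector space, the statement is assembled from two theorems
of the tree: the torus `ℂ/Φ(ℤ^ι)` is the analytification of a smooth projective curve (Weierstrass `℘`,
`exists_isAnalytification_complexTorus_dimOne`, Silverman VI Prop. 3.6 (b)), and the uniformising torus
of a smooth projective variety carries a Riemann form (`isAbelianVariety_of_isAnalytification`,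
Lange–Birkenhake Thm. 2.1.13 (ii) ⇒ (i)); a general `E` of dimension `1` is moved to `ℂ¹` along a
`ℂ`-linear isomorphism (`ComplexTorus.IsAbelianVariety.of_equiv`).

* `isAbelianVariety_dimOne Φ` — every `Φ : ℝ^ι ≃ ℂ¹` gives an abelian variety;
* `isAbelianVariety_of_finrank_eq_one` — every complex torus `E/Φ(ℤ^ι)` with `dim_ℂ E = 1` is an
  abelian variety.

Everything is proved; no named fact.

## References

* [LangeBirkenhake1992] H. Lange, Ch. Birkenhake, *Complex Abelian Varieties* (1992), §2.1 Thm. 2.1.13,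
  Cor. 2.1.14.
* [Lange2023AbelianVarietiesComplex] H. Lange, *Abelian Varieties over the Complex Numbers* (2023), §2.1.1
  Example 2.1.3 (held copy `book:lange1992-complex-abelian-varieties`, p0076).
* [SilvermanAEC2009] J. Silverman, *The Arithmetic of Elliptic Curves*, VI Prop. 3.6 (b).
-/

noncomputable section

open Module
open Literature.Geometry.Kaehler

namespace Literature.AlgebraicGeometry.HodgeTheory

variable {ι : Type} [Fintype ι] [DecidableEq ι]

/-- **Every complex torus `ℂ¹/Φ(ℤ^ι)` is an abelian variety** (it is the analytification of a smooth
projective curve, hence polarised). [cite: LangeBirkenhake1992, §2.1 Thm. 2.1.13 and Cor. 2.1.14] -/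
theorem isAbelianVariety_dimOne (Φ : (ι → ℝ) ≃L[ℝ] (Fin 1 → ℂ)) :
    ComplexTorus.IsAbelianVariety Φ := by
  obtain ⟨X, hX, φ, hφ⟩ := exists_isAnalytification_complexTorus_dimOne Φ
  exact isAbelianVariety_of_isAnalytification Φ hX φ hφ

/-- **Every complex torus of dimension one is an abelian variety**: for every period isomorphism
`Φ : ℝ^ι ≃ E` onto a complex vector space of dimension `1`, `E/Φ(ℤ^ι)` admits a Riemann form.
[cite: LangeBirkenhake1992, §2.1 Cor. 2.1.14] [cite: Lange2023AbelianVarietiesComplex, §2.1.1 Example 2.1.3] -/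
theorem isAbelianVariety_of_finrank_eq_one {E : Type} [NormedAddCommGroup E] [NormedSpace ℂ E]
    (hE : finrank ℂ E = 1) (Φ : (ι → ℝ) ≃L[ℝ] E) : ComplexTorus.IsAbelianVariety Φ := by
  haveI : FiniteDimensional ℂ E := Module.finite_of_finrank_eq_succ hE
  have h1 : finrank ℂ E = finrank ℂ (Fin 1 → ℂ) := by
    rw [hE, finrank_fintype_fun_eq_card, Fintype.card_fin]
  exact ComplexTorus.IsAbelianVariety.of_equiv Φ (ContinuousLinearEquiv.ofFinrankEq h1)
    (isAbelianVariety_dimOne (ComplexTorus.transPeriod Φ _))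

end Literature.AlgebraicGeometry.HodgeTheory

end
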